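import Literature.Geometry.Lorentzian.AsymptoticallyFlatChart
import Literature.Topology.FourManifolds.GluingConstruction
import Mathlib.Geometry.Euclidean.Inversion.Calculus
import HarnessLib

/-!
# The one-point compactification of an asymptotically flat end as a smooth manifold
# (Bray 2001, proof of Thm. 8: "the points at infinity `{∞_k}` in the compactified ends")

Bray, J. Differential Geom. 59 (2001) 177–267, §6, proof of Thm. 8: *"the metric `g̃ = φ⁴ḡ` in
each end is conformal to a punctured ball … this harmonic function can be extended to the whole
ball, which proves that the metric `g̃` can be extended smoothly over all of the points at
infinity in the compactified ends. … since `(M³ ∪ {∞_k}, g̃)` is a complete 3-manifold with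
nonnegative scalar curvature with a single harmonically flat end, we may apply the Riemannian
positive mass theorem to this manifold"*. The analytic half of this step (the conformal factor
extends smoothly and harmonically across the added point) is `KelvinTransformAtInfinity.lean`;
this file supplies the **differential-topological half**: the smooth `3`-manifold `M ∪ {∞}`.

Construction. Let `e` be an end of the `3`-manifold `X` (`AFEnd X`: an open `U ⊆ X` with a
diffeomorphism `chart : U ≅ {R < |x|} ⊆ ℝ³`) and `R' ≥ R`. The **inversion in the unit sphere**
`ι(x) = x/|x|²` (Mathlib's `EuclideanGeometry.inversion 0 1`, an involution of `ℝ³ ∖ {0}`,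
`|ι(x)| = |x|⁻¹`) identifies the far region `far R' = chart⁻¹{R' < |x|}` with the punctured ball
`{0 < |y| < 1/R'}`. The compactification `X ∪_e {∞}` is the **open gluing** (pushout, the tree's
`Literature.Topology.FourManifolds.SmoothGlueData.Glued`, Kosinski VI.1) of `X` and the open ball
`B(0, 1/R') ⊆ ℝ³` along the partial diffeomorphism `q ↦ ι(chart q) : far R' ≅ B(0, 1/R') ∖ {0}`;
the added point `∞` is the centre of the ball, and `y` is a smooth chart around it in which the
end reads `x = y/|y|²` — exactly the coordinate in which Bray (following Folland's Kelvin
transform, Prop. 2.74) extends `g̃`.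

## Main definitions and results

* `inversion_zero_one_eq`, `norm_inversion_zero_one`, `contDiffAt_inversion_zero_one`: the unit
  inversion of `ℝ³` is `x ↦ |x|⁻² x`, has norm `|x|⁻¹`, and is smooth off the origin (Mathlib);
  `fderiv_inversion_zero_one`, `inner_fderiv_inversion_zero_one`: its differential is `|x|⁻²`
  times a reflection, so it is **conformal**, `⟨dι a, dι b⟩ = |x|⁻⁴ ⟨a, b⟩` (Folland's
  `g_ij = |y|⁻⁴ δ_ij`) — the identity behind `g̃ = W⁴ δ_y` in the cap chart.
* `AFEnd.capGlue e hR'`: the gluing partial homeomorphism `X ⇀ B(0, 1/R')`, source `far R'`,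
  target the punctured ball; `AFEnd.capGlueData`: the `SmoothGlueData` (smooth in both directions).
* `AFEnd.Compactification e hR'` — **the manifold `X ∪_e {∞}`**: a `C^∞` manifold modelled on
  `ℝ³` (`ChartedSpace E3`, `IsManifold (𝓡 3) ∞`), with the open smooth embedding
  `AFEnd.Compactification.incl : X → X ∪ {∞}`, the cap chart `AFEnd.Compactification.cap` (the
  open embedding of the ball) and the point `AFEnd.Compactification.infty = cap 0`;
  `compl_range_incl : (range incl)ᶜ = {∞}`.
* Instances: `T2Space` (the graph of the gluing map is closed: near a point `(q, 0)` of its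
  closure the coordinate `|chart q'|` would have to be unbounded, which the closedness at
  infinity of the end, `AFEnd.isClosed_far`, forbids), `SigmaCompactSpace`,
  `SecondCountableTopology`, `ConnectedSpace` (the image of `X` is connected and dense) and
  `Nonempty`.

The Riemannian structure on `X ∪ {∞}` (Bray's `g̃` glued with `W⁴ δ`, `W` the Kelvin transform)
and the transfer of the other ends are left to the sequel; nothing here involves a metric.
Definitions with bodies and proved theorems only; no named facts are introduced.

## References

* H. L. Bray, *Proof of the Riemannian Penrose inequality using the positive mass theorem*,
  J. Differential Geom. 59 (2001) 177–267, §6, proof of Thm. 8. [BrayRPI2001]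
* A. A. Kosinski, *Differential Manifolds*, Academic Press (1993), VI.1 (gluing of manifolds along
  open subsets). [Kosinski1993]
* G. B. Folland, *Introduction to Partial Differential Equations*, 2nd ed. (1995), §2.I,
  Prop. (2.74) (the inverted coordinate at infinity). [Folland2020]
-/

noncomputable section

open Set Function Metric TopologicalSpace EuclideanGeometry Filter Topology
open scoped Manifold ContDiff Topology

namespace Literature.Geometry.Lorentzian

open Literature.Topology.FourManifolds

/-! ### Inversion in the unit sphere of `ℝ³` -/

/-- The unit inversion of `ℝ³` centred at the origin is `x ↦ |x|⁻² x`. [folklore] -/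
theorem inversion_zero_one_eq (x : E3) : inversion (0 : E3) 1 x = (‖x‖ ^ 2)⁻¹ • x := by
  simp [inversion, one_div, inv_pow]

/-- `|ι(x)| = |x|⁻¹` for the unit inversion `ι` (also at `x = 0`, both sides being `0`).
[folklore] -/
theorem norm_inversion_zero_one (x : E3) : ‖inversion (0 : E3) 1 x‖ = ‖x‖⁻¹ := by
  have h := dist_inversion_center (0 : E3) x 1
  rwa [dist_zero_right, dist_zero_right, one_pow, one_div] at h

/-- The unit inversion does not hit the origin off the origin. [folklore] -/
theorem inversion_zero_one_ne_zero {x : E3} (hx : x ≠ 0) : inversion (0 : E3) 1 x ≠ 0 :=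
  fun h ↦ hx ((inversion_eq_center one_ne_zero).1 h)

/-- The unit inversion is an involution (Mathlib's `inversion_inversion`). [folklore] -/
theorem inversion_zero_one_inversion (x : E3) :
    inversion (0 : E3) 1 (inversion (0 : E3) 1 x) = x :=
  inversion_inversion (0 : E3) one_ne_zero x

/-- The unit inversion is `C^n` off the origin (Mathlib). [folklore] -/
theorem contDiffAt_inversion_zero_one {x : E3} (hx : x ≠ 0) {n : ℕ∞} :
    ContDiffAt ℝ n (inversion (0 : E3) 1) x :=
  (contDiffAt_const (c := (0 : E3))).inversion (contDiffAt_const (c := (1 : ℝ))) contDiffAt_id hx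

/-- The unit inversion is continuous off the origin. [folklore] -/
theorem continuousOn_inversion_zero_one : ContinuousOn (inversion (0 : E3) 1) {0}ᶜ :=
  continuousOn_const.inversion continuousOn_const continuousOn_id fun _ h ↦ h

/-- For `y ≠ 0` with `|y| < R'⁻¹` the inverted point has `R' < |ι(y)|`. [folklore] -/
theorem lt_norm_inversion_of_norm_lt {R' : ℝ} {y : E3} (hy : y ≠ 0)
    (hyR : ‖y‖ < R'⁻¹) : R' < ‖inversion (0 : E3) 1 y‖ := by
  rw [norm_inversion_zero_one]
  have h := inv_strictAnti₀ (norm_pos_iff.2 hy) hyR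
  rwa [inv_inv] at h

/-- **The differential of the unit inversion** at `x ≠ 0` is `|x|⁻²` times the reflection in the
plane orthogonal to `x` (Mathlib's `hasFDerivAt_inversion`). [folklore] -/
theorem fderiv_inversion_zero_one {x : E3} (hx : x ≠ 0) :
    fderiv ℝ (inversion (0 : E3) 1) x =
      (‖x‖ ^ 2)⁻¹ • ((ℝ ∙ x)ᗮ.reflection : E3 →L[ℝ] E3) := by
  have h := (hasFDerivAt_inversion (c := (0 : E3)) (R := 1) hx).fderiv
  rw [h, dist_zero_right, sub_zero, one_div, inv_pow]

/-- The differential of the unit inversion, applied to a vector. [folklore] -/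
theorem fderiv_inversion_zero_one_apply {x : E3} (hx : x ≠ 0) (a : E3) :
    fderiv ℝ (inversion (0 : E3) 1) x a = (‖x‖ ^ 2)⁻¹ • (ℝ ∙ x)ᗮ.reflection a := by
  rw [fderiv_inversion_zero_one hx]
  rfl

/-- **The unit inversion is conformal**: `⟨dι_x a, dι_x b⟩ = |x|⁻⁴ ⟨a, b⟩` for `x ≠ 0` — in
Folland's notation the pulled-back flat metric is `g_ij = |y|⁻⁴ δ_ij` (§2.I, before (2.72)).
[cite: Folland2020, §2.I (2.72)] -/
theorem inner_fderiv_inversion_zero_one {x : E3} (hx : x ≠ 0) (a b : E3) :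
    inner ℝ (fderiv ℝ (inversion (0 : E3) 1) x a) (fderiv ℝ (inversion (0 : E3) 1) x b) =
      ((‖x‖ ^ 2)⁻¹) ^ 2 * inner ℝ a b := by
  rw [fderiv_inversion_zero_one_apply hx, fderiv_inversion_zero_one_apply hx,
    real_inner_smul_left, real_inner_smul_right, LinearIsometryEquiv.inner_map_map]
  ring

/-- The unit inversion scales lengths by `|x|⁻²`: `‖dι_x a‖ = |x|⁻² ‖a‖` (`x ≠ 0`). [folklore] -/
theorem norm_fderiv_inversion_zero_one {x : E3} (hx : x ≠ 0) (a : E3) :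
    ‖fderiv ℝ (inversion (0 : E3) 1) x a‖ = (‖x‖ ^ 2)⁻¹ * ‖a‖ := by
  rw [fderiv_inversion_zero_one_apply hx, norm_smul, LinearIsometryEquiv.norm_map,
    Real.norm_eq_abs, abs_inv, abs_of_nonneg (sq_nonneg ‖x‖)]

/-! ### The coordinate cap -/

/-- **The coordinate cap**: the open ball `B(0, ρ) ⊆ ℝ³`, as an open submanifold of `ℝ³`; its
centre will be the point at infinity. [folklore] -/
def capBall (ρ : ℝ) : Opens E3 := ⟨ball (0 : E3) ρ, isOpen_ball⟩

/-- Membership in the cap. [folklore] -/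
@[simp] theorem mem_capBall {ρ : ℝ} {y : E3} : y ∈ capBall ρ ↔ ‖y‖ < ρ := mem_ball_zero_iff

/-- The coercion of the cap to a set is the ball. [folklore] -/
@[simp] theorem coe_capBall (ρ : ℝ) : ((capBall ρ : Opens E3) : Set E3) = ball (0 : E3) ρ := rfl

/-- The cap is σ-compact (an open subset of `ℝ³`). [folklore] -/
instance (ρ : ℝ) : SigmaCompactSpace (capBall ρ) := by
  haveI : LocallyCompactSpace (capBall ρ) := (capBall ρ).2.locallyCompactSpace
  infer_instance

namespace AFEnd

variable {X : Type} [TopologicalSpace X] [ChartedSpace E3 X] (e : AFEnd X) {R' : ℝ}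

/-! ### The gluing map: the inverted coordinate of the end -/

/-- Points of a far region lie in the end. [folklore] -/
theorem mem_U_of_mem_far {q : X} (hq : q ∈ e.far R') : q ∈ e.U := by
  obtain ⟨hU, -⟩ := e.mem_far_iff_coord.1 hq
  exact hU

/-- Points of the far region `far R'` have coordinate norm `> R'`. [folklore] -/
theorem lt_norm_coord_of_mem_far {q : X} (hq : q ∈ e.far R') : R' < ‖e.coord q‖ := by
  obtain ⟨-, h⟩ := e.mem_far_iff_coord.1 hq
  exact h

/-- A point of the end with coordinate norm `> R'` lies in `far R'`. [folklore] -/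
theorem mem_far_of_lt_norm_coord {q : X} (hq : q ∈ e.U) (h : R' < ‖e.coord q‖) : q ∈ e.far R' :=
  e.mem_far_iff_coord.2 ⟨hq, h⟩

/-- Points of the closed far set `chart⁻¹{N ≤ |x|}` have coordinate norm `≥ N`. [folklore] -/
theorem le_norm_coord_of_mem_image {N : ℝ} {q : X}
    (hq : q ∈ ((↑) : e.U → X) '' (e.chart ⁻¹' {x | N ≤ ‖(x : E3)‖})) : N ≤ ‖e.coord q‖ := by
  obtain ⟨u, hu, rfl⟩ := hq
  rw [e.coord_of_mem u.2]
  exact hu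

/-- A point of the end with coordinate norm `≥ N` lies in the closed far set `chart⁻¹{N ≤ |x|}`.
[folklore] -/
theorem mem_image_of_le_norm_coord {N : ℝ} {q : X} (hq : q ∈ e.U) (h : N ≤ ‖e.coord q‖) :
    q ∈ ((↑) : e.U → X) '' (e.chart ⁻¹' {x | N ≤ ‖(x : E3)‖}) := by
  refine ⟨⟨q, hq⟩, ?_, rfl⟩
  show N ≤ ‖(e.chart ⟨q, hq⟩ : E3)‖
  rwa [← e.coord_of_mem hq]

/-- `R' > 0` when `R' ≥ R`. [folklore] -/
theorem capRadius_pos (hR' : e.R ≤ R') : 0 < R' := e.R_pos.trans_le hR'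

/-- The coordinate does not vanish on a far region `far R'`, `R' ≥ R`. [folklore] -/
theorem coord_ne_zero_of_mem_far (hR' : e.R ≤ R') {q : X} (hq : q ∈ e.far R') : e.coord q ≠ 0 := by
  intro h0
  have h := e.lt_norm_coord_of_mem_far hq
  rw [h0, norm_zero] at h
  exact lt_irrefl _ (h.trans (e.capRadius_pos hR'))

/-- **The gluing map** of the compactification of the end at scale `R' ≥ R`: the inverted
coordinate `q ↦ ι(chart q) = chart q / |chart q|²`, a point of the cap `B(0, 1/R')` when
`q ∈ far R'`; junk value the centre elsewhere. [cite: BrayRPI2001, §6 proof of Thm. 8] -/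
def capMap (hR' : e.R ≤ R') (q : X) : capBall R'⁻¹ :=
  open scoped Classical in
  if h : q ∈ e.far R' then
    ⟨inversion (0 : E3) 1 (e.coord q), by
      rw [mem_capBall, norm_inversion_zero_one]
      exact inv_strictAnti₀ (e.capRadius_pos hR') (e.lt_norm_coord_of_mem_far h)⟩
  else ⟨0, by rw [mem_capBall, norm_zero, inv_pos]; exact e.capRadius_pos hR'⟩

/-- On the far region the gluing map is the inverted coordinate. [folklore] -/
theorem coe_capMap_of_mem (hR' : e.R ≤ R') {q : X} (hq : q ∈ e.far R') :
    (e.capMap hR' q : E3) = inversion (0 : E3) 1 (e.coord q) := by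
  rw [capMap, dif_pos hq]

/-- On the far region the gluing map does not hit the centre. [folklore] -/
theorem coe_capMap_ne_zero (hR' : e.R ≤ R') {q : X} (hq : q ∈ e.far R') :
    (e.capMap hR' q : E3) ≠ 0 := by
  rw [e.coe_capMap_of_mem hR' hq]
  exact inversion_zero_one_ne_zero (e.coord_ne_zero_of_mem_far hR' hq)

/-- **The inverse gluing map**: a point `y` of `ℝ³` is sent to the point of the end with
coordinate `ι(y) = y/|y|²` (junk unless `R < |ι(y)|`). [cite: BrayRPI2001, §6 proof of Thm. 8] -/
def capInv (y : E3) : X := e.dataChartExt (inversion (0 : E3) 1 y)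

/-- For `0 < |y| < 1/R'` the inverted point lies beyond `R`. [folklore] -/
theorem R_lt_norm_inversion (hR' : e.R ≤ R') {y : E3} (hy : y ≠ 0) (hyR : ‖y‖ < R'⁻¹) :
    e.R < ‖inversion (0 : E3) 1 y‖ :=
  lt_of_le_of_lt hR' (lt_norm_inversion_of_norm_lt hy hyR)

/-- For `0 < |y| < 1/R'`, `capInv y` is the chart preimage of `ι(y)`. [folklore] -/
theorem capInv_eq (hR' : e.R ≤ R') {y : E3} (hy : y ≠ 0) (hyR : ‖y‖ < R'⁻¹) :
    e.capInv y = e.dataChart ⟨inversion (0 : E3) 1 y, e.R_lt_norm_inversion hR' hy hyR⟩ :=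
  e.dataChartExt_of_lt _

/-- For `0 < |y| < 1/R'`, `capInv y ∈ far R'`. [folklore] -/
theorem capInv_mem_far (hR' : e.R ≤ R') {y : E3} (hy : y ≠ 0) (hyR : ‖y‖ < R'⁻¹) :
    e.capInv y ∈ e.far R' := by
  rw [e.capInv_eq hR' hy hyR, e.mem_far_iff]
  exact ⟨⟨inversion (0 : E3) 1 y, e.R_lt_norm_inversion hR' hy hyR⟩,
    lt_norm_inversion_of_norm_lt hy hyR, rfl⟩

/-- The coordinate of `capInv y` is `ι(y)` (`0 < |y| < 1/R'`). [folklore] -/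
theorem coord_capInv (hR' : e.R ≤ R') {y : E3} (hy : y ≠ 0) (hyR : ‖y‖ < R'⁻¹) :
    e.coord (e.capInv y) = inversion (0 : E3) 1 y := by
  rw [e.capInv_eq hR' hy hyR]
  exact e.coord_dataChart _

/-- Left inverse: `capInv (capMap q) = q` on `far R'`. [folklore] -/
theorem capInv_capMap (hR' : e.R ≤ R') {q : X} (hq : q ∈ e.far R') :
    e.capInv (e.capMap hR' q) = q := by
  have hqU : q ∈ e.U := e.mem_U_of_mem_far hq
  show e.dataChartExt (inversion (0 : E3) 1 (e.capMap hR' q : E3)) = q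
  rw [e.coe_capMap_of_mem hR' hq, inversion_zero_one_inversion,
    e.dataChartExt_of_lt (e.lt_norm_coord hqU)]
  exact e.dataChart_coord hqU

/-- Right inverse: `capMap (capInv y) = y` on the punctured cap. [folklore] -/
theorem capMap_capInv (hR' : e.R ≤ R') {y : capBall R'⁻¹} (hy : (y : E3) ≠ 0) :
    e.capMap hR' (e.capInv y) = y := by
  have hyR : ‖(y : E3)‖ < R'⁻¹ := mem_capBall.1 y.2
  apply Subtype.ext
  rw [e.coe_capMap_of_mem hR' (e.capInv_mem_far hR' hy hyR), e.coord_capInv hR' hy hyR,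
    inversion_zero_one_inversion]

/-- The gluing map is continuous on the far region. [folklore] -/
theorem continuousOn_capMap (hR' : e.R ≤ R') : ContinuousOn (e.capMap hR') (e.far R') := by
  rw [IsInducing.subtypeVal.continuousOn_iff]
  have hcoord : ContinuousOn e.coord (e.far R') := fun q hq ↦
    (e.contMDiffAt_coord (e.mem_U_of_mem_far hq)).continuousAt.continuousWithinAt
  have hcomp : ContinuousOn (inversion (0 : E3) 1 ∘ e.coord) (e.far R') :=
    continuousOn_inversion_zero_one.comp hcoord fun q hq ↦ e.coord_ne_zero_of_mem_far hR' hq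
  exact hcomp.congr fun q hq ↦ e.coe_capMap_of_mem hR' hq

/-- The inverse gluing map is continuous at the points of the punctured cap. [folklore] -/
theorem continuousAt_capInv (hR' : e.R ≤ R') {y : E3} (hy : y ≠ 0) (hyR : ‖y‖ < R'⁻¹) :
    ContinuousAt e.capInv y :=
  (e.contMDiffAt_dataChartExt (e.R_lt_norm_inversion hR' hy hyR)).continuousAt.comp
    (contDiffAt_inversion_zero_one (n := 0) hy).continuousAt

/-- **The gluing partial homeomorphism** `X ⇀ B(0, 1/R')` of the compactification of the end:
source the far region `far R'`, target the punctured cap, `q ↦ ι(chart q)` with inverse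
`y ↦ chart⁻¹(ι y)`. [cite: BrayRPI2001, §6 proof of Thm. 8] -/
def capGlue (hR' : e.R ≤ R') : OpenPartialHomeomorph X (capBall R'⁻¹) where
  toFun := e.capMap hR'
  invFun := fun y ↦ e.capInv y
  source := e.far R'
  target := {y | (y : E3) ≠ 0}
  map_source' := fun _ hq ↦ e.coe_capMap_ne_zero hR' hq
  map_target' := fun y hy ↦ e.capInv_mem_far hR' hy (mem_capBall.1 y.2)
  left_inv' := fun _ hq ↦ e.capInv_capMap hR' hq
  right_inv' := fun _ hy ↦ e.capMap_capInv hR' hy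
  open_source := e.isOpen_far R'
  open_target := isOpen_compl_singleton.preimage continuous_subtype_val
  continuousOn_toFun := e.continuousOn_capMap hR'
  continuousOn_invFun := fun y hy ↦
    ((e.continuousAt_capInv hR' hy (mem_capBall.1 y.2)).comp
      continuous_subtype_val.continuousAt).continuousWithinAt

/-- `capGlue` as a function. [folklore] -/
@[simp] theorem coe_capGlue (hR' : e.R ≤ R') : (e.capGlue hR' : X → capBall R'⁻¹) = e.capMap hR' :=
  rfl

/-- The inverse of `capGlue` as a function. [folklore] -/
@[simp] theorem coe_capGlue_symm (hR' : e.R ≤ R') :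
    ((e.capGlue hR').symm : capBall R'⁻¹ → X) = fun y : capBall R'⁻¹ ↦ e.capInv (y : E3) := rfl

/-- The source of `capGlue` is the far region. [folklore] -/
@[simp] theorem capGlue_source (hR' : e.R ≤ R') : (e.capGlue hR').source = e.far R' := rfl

/-- The target of `capGlue` is the punctured cap. [folklore] -/
@[simp] theorem capGlue_target (hR' : e.R ≤ R') :
    (e.capGlue hR').target = {y : capBall R'⁻¹ | (y : E3) ≠ 0} := rfl

/-- The gluing map is `C^∞` on the far region (inversion is smooth off the origin, the chart is
smooth, and a map into an open submanifold is smooth iff it is smooth into the ambient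
manifold). [folklore] -/
theorem contMDiffOn_capGlue (hR' : e.R ≤ R') :
    ContMDiffOn (𝓡 3) (𝓡 3) ∞ (e.capGlue hR') (e.capGlue hR').source := by
  intro q hq
  have hq' : q ∈ e.far R' := hq
  have hqU : q ∈ e.U := e.mem_U_of_mem_far hq'
  have hcomp : ContMDiffAt (𝓡 3) 𝓘(ℝ, E3) ∞ (inversion (0 : E3) 1 ∘ e.coord) q :=
    (contDiffAt_inversion_zero_one (e.coord_ne_zero_of_mem_far hR' hq')).contMDiffAt.comp q
      (e.contMDiffAt_coord hqU)
  have hev : (Subtype.val ∘ e.capMap hR') =ᶠ[𝓝 q] (inversion (0 : E3) 1 ∘ e.coord) := by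
    filter_upwards [(e.isOpen_far R').mem_nhds hq'] with q' hq'
    exact e.coe_capMap_of_mem hR' hq'
  have h : ContMDiffAt (𝓡 3) (𝓡 3) ∞ (Subtype.val ∘ e.capMap hR') q :=
    hcomp.congr_of_eventuallyEq hev
  exact ((ContMDiffAt.subtypeVal_comp_iff (capBall R'⁻¹) (e.capMap hR') q).1 h).contMDiffWithinAt

/-- The inverse gluing map is `C^∞` on the punctured cap. [folklore] -/
theorem contMDiffOn_capGlue_symm (hR' : e.R ≤ R') :
    ContMDiffOn (𝓡 3) (𝓡 3) ∞ (e.capGlue hR').symm (e.capGlue hR').target := by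
  intro y hy
  have hy' : (y : E3) ≠ 0 := hy
  have hyR : ‖(y : E3)‖ < R'⁻¹ := mem_capBall.1 y.2
  have h1 : ContMDiffAt 𝓘(ℝ, E3) (𝓡 3) ∞ e.capInv (y : E3) :=
    (e.contMDiffAt_dataChartExt (e.R_lt_norm_inversion hR' hy' hyR)).comp (y : E3)
      (contDiffAt_inversion_zero_one hy').contMDiffAt
  have h2 : ContMDiffAt (𝓡 3) (𝓡 3) ∞ (fun y : capBall R'⁻¹ ↦ e.capInv y) y :=
    h1.comp y (contMDiff_subtype_val (U := capBall R'⁻¹) y)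
  exact h2.contMDiffWithinAt

/-- **The gluing datum** of the compactification: `X` and the cap `B(0, 1/R')`, both modelled on
`ℝ³`, glued along `capGlue`. [cite: BrayRPI2001, §6 proof of Thm. 8] -/
def capGlueData (hR' : e.R ≤ R') : SmoothGlueData (𝓡 3) (𝓡 3) X (capBall R'⁻¹) E3 where
  glue := e.capGlue hR'
  contMDiffOn_glue := e.contMDiffOn_capGlue hR'
  contMDiffOn_glue_symm := e.contMDiffOn_capGlue_symm hR'
  linA := ContinuousLinearEquiv.refl ℝ E3
  linB := ContinuousLinearEquiv.refl ℝ E3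

/-- **The graph of the gluing map is closed** in `X × B(0, 1/R')`: away from the centre it is the
graph of the continuous inverse `capInv` over the (open) punctured cap; and no point `(q, 0)` is
in its closure, because on the neighbourhood `X ∖ chart⁻¹{N ≤ |x|}` of `q` (closed at infinity,
`AFEnd.isClosed_far`) glued points have `|y| = |chart q'|⁻¹ > 1/N`. [folklore] -/
theorem isClosed_capGlue_graph [T2Space X] (hR' : e.R ≤ R') :
    IsClosed {p : X × capBall R'⁻¹ | p.1 ∈ (e.capGlue hR').source ∧ e.capGlue hR' p.1 = p.2} := by
  have hR0 : 0 < R' := e.capRadius_pos hR'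
  rw [← isOpen_compl_iff, isOpen_iff_forall_mem_open]
  rintro ⟨q, y⟩ hp
  have hp' : ¬(q ∈ e.far R' ∧ e.capMap hR' q = y) := hp
  by_cases hy : (y : E3) = 0
  · -- near a centre point: the coordinate of glued points near `q` is bounded by `N`
    set N : ℝ := max (e.R + 1) (‖e.coord q‖ + 1) with hN
    have hNR : e.R < N := lt_of_lt_of_le (by linarith) (le_max_left _ _)
    have hN0 : 0 < N := e.R_pos.trans hNR
    set C : Set X := ((↑) : e.U → X) '' (e.chart ⁻¹' {x | N ≤ ‖(x : E3)‖}) with hC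
    have hCcl : IsClosed C := e.isClosed_far N hNR
    have hqC : q ∉ C := fun h ↦ by
      have h1 : N ≤ ‖e.coord q‖ := e.le_norm_coord_of_mem_image h
      have h2 : ‖e.coord q‖ + 1 ≤ N := le_max_right _ _
      linarith
    refine ⟨Cᶜ ×ˢ {y' : capBall R'⁻¹ | ‖(y' : E3)‖ < N⁻¹}, ?_, ?_, ?_⟩
    · rintro ⟨q', y'⟩ ⟨hq', hy'⟩ ⟨hsrc, hglue⟩
      have hsrc' : q' ∈ e.far R' := hsrc
      have hglue' : e.capMap hR' q' = y' := hglue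
      have hq'' : q' ∉ C := hq'
      have hy'' : ‖(y' : E3)‖ < N⁻¹ := hy'
      have hq'U : q' ∈ e.U := e.mem_U_of_mem_far hsrc'
      have hlt : ‖e.coord q'‖ < N := by
        by_contra hle
        exact hq'' (e.mem_image_of_le_norm_coord hq'U (not_lt.1 hle))
      have hpos : 0 < ‖e.coord q'‖ := hR0.trans (e.lt_norm_coord_of_mem_far hsrc')
      have hnorm : ‖(y' : E3)‖ = ‖e.coord q'‖⁻¹ := by
        rw [← hglue', e.coe_capMap_of_mem hR' hsrc', norm_inversion_zero_one]
      have : N⁻¹ < ‖(y' : E3)‖ := by rw [hnorm]; exact inv_strictAnti₀ hpos hlt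
      exact lt_irrefl _ (this.trans hy'')
    · exact hCcl.isOpen_compl.prod
        (isOpen_lt (continuous_norm.comp continuous_subtype_val) continuous_const)
    · refine ⟨hqC, ?_⟩
      show ‖(y : E3)‖ < N⁻¹
      rw [hy, norm_zero, inv_pos]
      exact hN0
  · -- near a punctured-cap point: the graph is the graph of the continuous `capInv`
    have hyR : ‖(y : E3)‖ < R'⁻¹ := mem_capBall.1 y.2
    have hne : q ≠ e.capInv y := by
      intro hq
      apply hp'
      rw [hq]
      exact ⟨e.capInv_mem_far hR' hy hyR, e.capMap_capInv hR' hy⟩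
    obtain ⟨U₁, V₁, hU₁, hV₁, hqU₁, hV₁', hUV⟩ := t2_separation hne
    have hcont : ContinuousOn (e.capGlue hR').symm {y' : capBall R'⁻¹ | (y' : E3) ≠ 0} :=
      (e.capGlue hR').continuousOn_symm
    obtain ⟨W, hW, hWeq⟩ := (continuousOn_iff'.1 hcont) V₁ hV₁
    refine ⟨U₁ ×ˢ (W ∩ {y' : capBall R'⁻¹ | (y' : E3) ≠ 0}), ?_, ?_, ?_⟩
    · rintro ⟨q', y'⟩ ⟨hq', hy'W, hy'0⟩ ⟨hsrc, hglue⟩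
      have hsrc' : q' ∈ e.far R' := hsrc
      have hglue' : e.capMap hR' q' = y' := hglue
      have hq'' : q' ∈ U₁ := hq'
      have hmem : y' ∈ (e.capGlue hR').symm ⁻¹' V₁ ∩ {y' : capBall R'⁻¹ | (y' : E3) ≠ 0} := by
        rw [hWeq]; exact ⟨hy'W, hy'0⟩
      have hq'eq : q' = e.capInv y' := by rw [← hglue', e.capInv_capMap hR' hsrc']
      rw [hq'eq] at hq''
      exact Set.disjoint_left.1 hUV hq'' hmem.1
    · exact hU₁.prod (hW.inter (isOpen_compl_singleton.preimage continuous_subtype_val))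
    · refine ⟨hqU₁, ?_, hy⟩
      have hmem : y ∈ (e.capGlue hR').symm ⁻¹' V₁ ∩ {y' : capBall R'⁻¹ | (y' : E3) ≠ 0} :=
        ⟨hV₁', hy⟩
      rw [hWeq] at hmem
      exact hmem.1

/-- The glued space is σ-compact when `X` is (images of two σ-compact spaces). [folklore] -/
theorem sigmaCompactSpace_glued [IsManifold (𝓡 3) ∞ X] [SigmaCompactSpace X] (hR' : e.R ≤ R') :
    SigmaCompactSpace (e.capGlueData hR').Glued := by
  rw [← isSigmaCompact_univ_iff, ← (e.capGlueData hR').range_inl_union_range_inr, union_eq_iUnion]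
  refine isSigmaCompact_iUnion _ fun b ↦ ?_
  cases b
  · exact isSigmaCompact_range (e.capGlueData hR').continuous_inr
  · exact isSigmaCompact_range (e.capGlueData hR').continuous_inl

/-! ### The compactified manifold `X ∪_e {∞}` -/

/-- **The one-point compactification of `X` at the end `e`** (at scale `R' ≥ R`): the open
gluing of `X` and the ball `B(0, 1/R') ⊆ ℝ³` along `q ↦ ι(chart q)` on `far R'`; Bray's
`M³ ∪ {∞_k}` for one end. [cite: BrayRPI2001, §6 proof of Thm. 8] -/
def Compactification (hR' : e.R ≤ R') : Type := (e.capGlueData hR').Glued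

namespace Compactification

variable (hR' : e.R ≤ R')

/-- `instance` (instance). [folklore] -/
instance : TopologicalSpace (e.Compactification hR') :=
  inferInstanceAs (TopologicalSpace (e.capGlueData hR').Glued)

/-- `instance` (instance). [folklore] -/
instance [IsManifold (𝓡 3) ∞ X] : ChartedSpace E3 (e.Compactification hR') :=
  inferInstanceAs (ChartedSpace E3 (e.capGlueData hR').Glued)

/-- `instance` (instance): `X ∪ {∞}` is a `C^∞` `3`-manifold (Kosinski VI.1). [folklore] -/
instance [IsManifold (𝓡 3) ∞ X] : IsManifold (𝓡 3) ∞ (e.Compactification hR') :=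
  inferInstanceAs (IsManifold 𝓘(ℝ, E3) ∞ (e.capGlueData hR').Glued)

/-- **The inclusion `X → X ∪ {∞}`.** [cite: BrayRPI2001, §6 proof of Thm. 8] -/
def incl : X → e.Compactification hR' := (e.capGlueData hR').inl

/-- **The cap chart** `B(0, 1/R') → X ∪ {∞}` (the inverted coordinate `y`, centred at `∞`).
[cite: BrayRPI2001, §6 proof of Thm. 8] -/
def cap : capBall R'⁻¹ → e.Compactification hR' := (e.capGlueData hR').inr

/-- The centre of the cap. [folklore] -/
def capCenter : capBall R'⁻¹ :=
  ⟨0, by rw [mem_capBall, norm_zero, inv_pos]; exact e.capRadius_pos hR'⟩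

/-- The centre of the cap is the origin. [folklore] -/
@[simp] theorem coe_capCenter : (capCenter e hR' : E3) = 0 := rfl

/-- **The point at infinity** `∞ = cap 0`. [cite: BrayRPI2001, §6 proof of Thm. 8] -/
def infty : e.Compactification hR' := cap e hR' (capCenter e hR')

/-- The inclusion is an open embedding. [folklore] -/
theorem isOpenEmbedding_incl : IsOpenEmbedding (incl e hR') :=
  (e.capGlueData hR').isOpenEmbedding_inl

/-- The cap chart is an open embedding. [folklore] -/
theorem isOpenEmbedding_cap : IsOpenEmbedding (cap e hR') :=
  (e.capGlueData hR').isOpenEmbedding_inr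

/-- The inclusion is continuous. [folklore] -/
theorem continuous_incl : Continuous (incl e hR') := (e.capGlueData hR').continuous_inl

/-- The cap chart is continuous. [folklore] -/
theorem continuous_cap : Continuous (cap e hR') := (e.capGlueData hR').continuous_inr

/-- The inclusion is injective. [folklore] -/
theorem incl_injective : Injective (incl e hR') := (e.capGlueData hR').inl_injective

/-- The cap chart is injective. [folklore] -/
theorem cap_injective : Injective (cap e hR') := (e.capGlueData hR').inr_injective

/-- The inclusion is `C^∞`. [folklore] -/
theorem contMDiff_incl [IsManifold (𝓡 3) ∞ X] : ContMDiff (𝓡 3) (𝓡 3) ∞ (incl e hR') :=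
  (e.capGlueData hR').contMDiff_inl

/-- The cap chart is `C^∞`. [folklore] -/
theorem contMDiff_cap [IsManifold (𝓡 3) ∞ X] : ContMDiff (𝓡 3) (𝓡 3) ∞ (cap e hR') :=
  (e.capGlueData hR').contMDiff_inr

/-- The inclusion is a smooth embedding. [folklore] -/
theorem isSmoothEmbedding_incl [IsManifold (𝓡 3) ∞ X] :
    Manifold.IsSmoothEmbedding (𝓡 3) (𝓡 3) ∞ (incl e hR') :=
  (e.capGlueData hR').isSmoothEmbedding_inl

/-- The cap chart is a smooth embedding. [folklore] -/
theorem isSmoothEmbedding_cap [IsManifold (𝓡 3) ∞ X] :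
    Manifold.IsSmoothEmbedding (𝓡 3) (𝓡 3) ∞ (cap e hR') :=
  (e.capGlueData hR').isSmoothEmbedding_inr

/-- **The identification**: `incl q = cap y` iff `q ∈ far R'` and `y = ι(chart q)`. [folklore] -/
theorem incl_eq_cap_iff {q : X} {y : capBall R'⁻¹} :
    incl e hR' q = cap e hR' y ↔ q ∈ e.far R' ∧ e.capMap hR' q = y :=
  (e.capGlueData hR').inl_eq_inr_iff

/-- On the far region, `incl q = cap (ι (chart q))`. [folklore] -/
theorem cap_capMap {q : X} (hq : q ∈ e.far R') : cap e hR' (e.capMap hR' q) = incl e hR' q :=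
  (e.capGlueData hR').inr_glue hq

/-- On the punctured cap, `cap y = incl (chart⁻¹ (ι y))`. [folklore] -/
theorem incl_capInv {y : capBall R'⁻¹} (hy : (y : E3) ≠ 0) :
    incl e hR' (e.capInv y) = cap e hR' y :=
  (e.capGlueData hR').inl_glue_symm hy

/-- Every point is in the image of `X` or in the cap. [folklore] -/
theorem range_incl_union_range_cap : range (incl e hR') ∪ range (cap e hR') = univ :=
  (e.capGlueData hR').range_inl_union_range_inr

/-- A cap point is in the image of `X` iff it is not the centre. [folklore] -/
theorem cap_mem_range_incl_iff {y : capBall R'⁻¹} :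
    cap e hR' y ∈ range (incl e hR') ↔ (y : E3) ≠ 0 :=
  (e.capGlueData hR').inr_mem_range_inl_iff

/-- **`X ∪ {∞}` is `X` plus one point**: the complement of the image of `X` is `{∞}`. [folklore] -/
theorem compl_range_incl : (range (incl e hR'))ᶜ = {infty e hR'} := by
  ext p
  simp only [mem_compl_iff, mem_singleton_iff]
  constructor
  · intro hp
    obtain (⟨q, rfl⟩ | ⟨y, rfl⟩) := (e.capGlueData hR').exists_inl_or_inr p
    · exact absurd (mem_range_self q) hp
    · have hy : (y : E3) = 0 := by
        by_contra h
        exact hp ((cap_mem_range_incl_iff e hR').2 h)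
      have : y = capCenter e hR' := Subtype.ext hy
      rw [this]
      rfl
  · rintro rfl hp
    exact ((cap_mem_range_incl_iff e hR').1 hp) rfl

/-- `∞` is not in the image of `X`. [folklore] -/
theorem infty_not_mem_range_incl : infty e hR' ∉ range (incl e hR') := by
  have h : infty e hR' ∈ (range (incl e hR'))ᶜ := by
    rw [compl_range_incl]
    exact mem_singleton _
  exact h

/-- The image of `X` is open. [folklore] -/
theorem isOpen_range_incl : IsOpen (range (incl e hR')) := (e.capGlueData hR').isOpen_range_inl

/-- The image of the cap is open. [folklore] -/
theorem isOpen_range_cap : IsOpen (range (cap e hR')) := (e.capGlueData hR').isOpen_range_inr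

/-! ### Separation, countability, connectedness -/

/-- **`X ∪ {∞}` is Hausdorff** (closed graph, Kosinski VI.1). [folklore] -/
instance [T2Space X] : T2Space (e.Compactification hR') :=
  (e.capGlueData hR').t2Space_of_isClosed_graph (e.isClosed_capGlue_graph hR')

/-- **`X ∪ {∞}` is σ-compact** when `X` is. [folklore] -/
instance [IsManifold (𝓡 3) ∞ X] [SigmaCompactSpace X] : SigmaCompactSpace (e.Compactification hR') :=
  e.sigmaCompactSpace_glued hR'

/-- **`X ∪ {∞}` is second countable** when `X` is σ-compact. [folklore] -/
instance [IsManifold (𝓡 3) ∞ X] [SigmaCompactSpace X] :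
    SecondCountableTopology (e.Compactification hR') := by
  haveI := e.sigmaCompactSpace_glued hR'
  exact (e.capGlueData hR').secondCountableTopology

/-- `∞` lies in the closure of the image of `X` (the punctured ball accumulates at its centre).
[folklore] -/
theorem infty_mem_closure_range_incl : infty e hR' ∈ closure (range (incl e hR')) := by
  -- the centre is in the closure of the punctured cap
  have hval : IsOpenMap (Subtype.val : capBall R'⁻¹ → E3) :=
    (capBall R'⁻¹).2.isOpenMap_subtype_val
  have hT : closure {y : capBall R'⁻¹ | (y : E3) ≠ 0} = univ := by
    have h1 : {y : capBall R'⁻¹ | (y : E3) ≠ 0} = Subtype.val ⁻¹' ({0}ᶜ : Set E3) := rfl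
    rw [h1, ← hval.preimage_closure_eq_closure_preimage continuous_subtype_val,
      (dense_compl_singleton (0 : E3)).closure_eq, preimage_univ]
  have h0 : capCenter e hR' ∈ closure {y : capBall R'⁻¹ | (y : E3) ≠ 0} := by
    rw [hT]; exact mem_univ _
  have h1 : infty e hR' ∈ closure (cap e hR' '' {y : capBall R'⁻¹ | (y : E3) ≠ 0}) :=
    image_closure_subset_closure_image (continuous_cap e hR') ⟨_, h0, rfl⟩
  refine closure_mono ?_ h1
  rintro _ ⟨y, hy, rfl⟩
  exact (cap_mem_range_incl_iff e hR').2 hy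

/-- The image of `X` is dense in `X ∪ {∞}`. [folklore] -/
theorem dense_range_incl : Dense (range (incl e hR')) := by
  intro p
  by_cases hp : p ∈ range (incl e hR')
  · exact subset_closure hp
  · have h : p ∈ (range (incl e hR'))ᶜ := hp
    rw [compl_range_incl, mem_singleton_iff] at h
    rw [h]
    exact infty_mem_closure_range_incl e hR'

/-- **`X ∪ {∞}` is connected** when `X` is (a dense connected subspace). [folklore] -/
instance [ConnectedSpace X] : ConnectedSpace (e.Compactification hR') := by
  rw [connectedSpace_iff_univ, ← (dense_range_incl e hR').closure_eq]
  exact (isConnected_range (continuous_incl e hR')).closure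

/-- `X ∪ {∞}` is nonempty. [folklore] -/
instance : Nonempty (e.Compactification hR') := ⟨infty e hR'⟩

end Compactification

end AFEnd

end Literature.Geometry.Lorentzian

end
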